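import Summits.NavierStokesRegularity.FunctionalMining.HsConvectionTrilinearSplit
import Summits.NavierStokesRegularity.FunctionalMining.HsProductionBoundRows
import HarnessLib

/-!
# FunctionalMining — the static production estimate of the family `EF.s` at EVERY real order `s > 1/2`

Search for candidate a priori estimates; no regularity claim. Cell `pub-nsfunc`, prove seat
(gen 12). The located gap `HsProductionBound s C` of `HsSaturatingLawReduction`
(`|N_s(v)| ≤ C (2ℰ)^{(2s−1)/(4s)} E_s^{1/2} E_{s+1}^{(2s+1)/(4s)}` on smooth divergence-free zero-mean
fields of `T³`) is PROVED for every real `s > 1/2` by ONE recipe (`exists_hsProductionBound`): the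
split trilinear bound `sq_hsInertialRate_le_trilinear_split` (`HsConvectionTrilinearSplit`) with half
of the weight moved onto the convective factors (`2r = s`) at the exponent triples
`(tᵢ) = (0, 3/2 − θ, θ)` and `(tᵢ') = (1/2 − θ, 1, θ)`, `θ = 1/(2s) ∈ (0, 1)`, gives

`N_s(v)² ≤ 2C₀ · E_{s+1} · E_{3/2−θ} · E_{s+θ}`,

and log-convexity of `t ↦ E_t` (`torusHsEnergy_interpolation`) closes it exactly:
`E_{3/2−θ} ≤ E_1^{1−θ} E_s^{θ}` (`3/2 − θ = (1−θ)·1 + θ·s` because `θs = 1/2`),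
`E_{s+θ} ≤ E_s^{1−θ} E_{s+1}^{θ}`, so `N_s² ≤ 2C₀ E_1^{1−θ} E_s E_{s+1}^{1+θ}` with `1 ∓ θ = (2s∓1)/(2s)`
and `E_1 = 2ℰ` — the exponents of `HsProductionBound` on the nose, with no case distinction in `s`.
Consequences (§2), for EVERY real `s > 1/2`: `hsEnergy_saturatingLaw`
(`∃ κ, SaturatingLaw (torusHsEnergy s) (2s−1) ((2s+1)/(2s−1)) κ`, i.e.
`dE_s/dt ≤ κ ν^{−(2s+1)/(2s−1)} (2ℰ) E_s^{1+1/(2s−1)}` along every zero-mean classical solution on `T³`: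
the K0 rows `EF.s | T_LD | G1` at real order; `s = 3/4, 5/4, 3/2` are the tabulated rows of
`HsProductionBoundRows`, `s = 1` is `hsEnergy_saturatingLaw_one`, `s = 2` is the palinstrophy row in
the normalisation `E_2 = ‖Δu‖₂²`, `hsEnergy_saturatingLaw_two`) and the Lyapunov mirrors
`hsEnergy_lyapunov` (`EK.EF.s | T_M0`). These are a priori differential inequalities along smooth
solutions (small-data closing only; the power `1 + 1/(2s−1) > 1` is supercritical for every `s`); no
regularity claim.
-/

noncomputable section

open MeasureTheory Set Filter Topology Function Real
open scoped InnerProductSpace RealInnerProductSpace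

namespace Summit.NavierStokesRegularity.FunctionalMining

open Literature.Analysis Literature.Analysis.FunctionSpaces Literature.Analysis.FluidPDE
open Literature.Analysis.FunctionSpaces.Torus Literature.Analysis.FluidPDE.Torus

/-! ## 1. The uniform recipe -/

/-- **The static production estimate of the family `EF.s` holds for every real `s > 1/2`**:
`∃ C ≥ 0, HsProductionBound s C`, i.e. `|N_s(v)| ≤ C (2ℰ)^{(2s−1)/(4s)} E_s^{1/2} E_{s+1}^{(2s+1)/(4s)}`
for all smooth divergence-free zero-mean `v` on `T³` (split trilinear bound at `2r = s`,
`(tᵢ) = (0, 3/2 − θ, θ)`, `(tᵢ') = (1/2 − θ, 1, θ)`, `θ = 1/(2s)`: `N_s² ≤ 2C₀ E_{s+1}E_{3/2−θ}E_{s+θ}`,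
then `E_{3/2−θ} ≤ E_1^{1−θ}E_s^θ`, `E_{s+θ} ≤ E_s^{1−θ}E_{s+1}^θ`; divergence-freeness is not used).
[ours] -/
theorem exists_hsProductionBound {s : ℝ} (hs : 1 / 2 < s) : ∃ C : ℝ, 0 ≤ C ∧ HsProductionBound s C := by
  have hs0 : 0 < s := by linarith
  have h2s : 0 < 2 * s := by linarith
  set θ : ℝ := 1 / (2 * s) with hθ
  have hθ0 : 0 < θ := by positivity
  have hθ1 : θ < 1 := by rw [hθ, div_lt_one h2s]; linarith
  have hθs : θ * s = 1 / 2 := by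
    rw [hθ, div_mul_eq_mul_div, one_mul, div_eq_iff h2s.ne']
    ring
  obtain ⟨C₀, hC₀, h⟩ := sq_hsInertialRate_le_trilinear_split (d := Fin 3) (by simp)
    (t₁ := 0) (t₂ := 3 / 2 - θ) (t₃ := θ) (t₁' := 1 / 2 - θ) (t₂' := 1) (t₃' := θ)
    (by norm_num) (by linarith) (by linarith) (by ring) (by linarith) (by norm_num) (by linarith) (by ring)
    (s := s) (r := s / 2) hs0 (by linarith) (by linarith)
    (by linarith) (by linarith) (by linarith) (by linarith) (by linarith) (by linarith)
  refine ⟨Real.sqrt (2 * C₀), Real.sqrt_nonneg _, fun v hv _ hmean => ?_⟩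
  have hN := h v hv hmean
  rw [show (0 : ℝ) + 1 + 2 * (s / 2) = s + 1 by ring, show θ + 2 * s - 2 * (s / 2) = s + θ by ring,
    show 1 / 2 - θ + 1 = 3 / 2 - θ by ring, show 1 + 2 * (s / 2) = s + 1 by ring] at hN
  rw [two_mul_torusEnstrophy_eq hv]
  set X := torusHsEnergy 1 v with hX
  set S := torusHsEnergy s v with hS
  set Z := torusHsEnergy (s + 1) v with hZ
  set U := torusHsEnergy (3 / 2 - θ) v with hU
  set V := torusHsEnergy (s + θ) v with hV
  have hX0 : 0 ≤ X := torusHsEnergy_nonneg (by norm_num) hv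
  have hS0 : 0 ≤ S := torusHsEnergy_nonneg hs0.le hv
  have hZ0 : 0 ≤ Z := torusHsEnergy_nonneg (by linarith) hv
  have hV0 : 0 ≤ V := torusHsEnergy_nonneg (by linarith) hv
  have iU : U ≤ X ^ (1 - θ) * S ^ θ :=
    torusHsEnergy_interp (s₀ := 1) (s₁ := s) (θ := θ) (by norm_num) hs0.le hθ0 hθ1 (by linarith [hθs]) rfl hv
  have iV : V ≤ S ^ (1 - θ) * Z ^ θ :=
    torusHsEnergy_interp (s₀ := s) (s₁ := s + 1) (θ := θ) hs0.le (by linarith) hθ0 hθ1 (by ring) rfl hv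
  -- exponent identities
  have hx2 : 2 * ((2 * s - 1) / (4 * s)) = 1 - θ := by
    rw [hθ]; field_simp; ring
  have hz2 : 2 * ((2 * s + 1) / (4 * s)) = 1 + θ := by
    rw [hθ]; field_simp; ring
  -- the monomial inequality
  have hZUV : Z * U * V ≤ X ^ (1 - θ) * S * Z ^ (1 + θ) := by
    calc Z * U * V ≤ Z * (X ^ (1 - θ) * S ^ θ) * (S ^ (1 - θ) * Z ^ θ) :=
          mul_le_mul (mul_le_mul_of_nonneg_left iU hZ0) iV hV0 (by positivity)
      _ = X ^ (1 - θ) * (S ^ θ * S ^ (1 - θ)) * (Z ^ (1 : ℝ) * Z ^ θ) := by rw [Real.rpow_one]; ring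
      _ = X ^ (1 - θ) * S * Z ^ (1 + θ) := by
          rw [← Real.rpow_add' hS0 (by rw [show θ + (1 - θ) = (1 : ℝ) by ring]; exact one_ne_zero),
            ← Real.rpow_add' hZ0 (ne_of_gt (by linarith)), show θ + (1 - θ) = (1 : ℝ) by ring, Real.rpow_one]
  have hN2 : hsInertialRate s v ^ 2 ≤
      2 * C₀ * (X ^ (2 * ((2 * s - 1) / (4 * s))) * S * Z ^ (2 * ((2 * s + 1) / (4 * s)))) := by
    rw [hx2, hz2]
    calc hsInertialRate s v ^ 2 ≤ C₀ * (Z * U * V + U * Z * V) := hN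
      _ = 2 * C₀ * (Z * U * V) := by ring
      _ ≤ 2 * C₀ * (X ^ (1 - θ) * S * Z ^ (1 + θ)) := mul_le_mul_of_nonneg_left hZUV (by positivity)
  exact abs_le_of_sq_le_rpow_mul (by positivity) hX0 hS0 hZ0 hN2

/-! ## 2. The rows `EF.s | T_LD | G1` and the mirrors `EK.EF.s | T_M0` at every real order `s > 1/2` -/

/-- **The rows `EF.s | T_LD | G1` at every real order `s > 1/2`**: there is `κ` with
`dE_s/dt ≤ κ ν^{−(2s+1)/(2s−1)} (2ℰ) E_s^{1+1/(2s−1)}` along every zero-mean classical solution on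
`T³` (`SaturatingLaw (torusHsEnergy s) (2s−1) ((2s+1)/(2s−1)) κ`; `exists_hsProductionBound` and
`exists_saturatingLaw_torusHsEnergy_of_productionBound`, `κ = C^{4s/(2s−1)}`). [ours] -/
theorem hsEnergy_saturatingLaw {s : ℝ} (hs : 1 / 2 < s) :
    ∃ κ : ℝ, SaturatingLaw (d := Fin 3) (torusHsEnergy s) (2 * s - 1) ((2 * s + 1) / (2 * s - 1)) κ := by
  obtain ⟨C, hC, h⟩ := exists_hsProductionBound hs
  exact exists_saturatingLaw_torusHsEnergy_of_productionBound hs hC h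

/-- **Row `EF.s=2 | T_LD | G1` in the normalisation `E_2 = ‖Δu‖₂² = 2𝒫`** (`σ = 3`, `γ = 5/3`):
`∃ κ, SaturatingLaw (torusHsEnergy 2) 3 (5/3) κ` (the palinstrophy row; cf. `MomentLyapunov` for the
explicit constant in the normalisation `𝒫`). [ours] -/
theorem hsEnergy_saturatingLaw_two : ∃ κ : ℝ, SaturatingLaw (d := Fin 3) (torusHsEnergy 2) 3 (5 / 3) κ := by
  obtain ⟨κ, hκ⟩ := hsEnergy_saturatingLaw (s := 2) (by norm_num)
  refine ⟨κ, ?_⟩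
  have e1 : (2 : ℝ) * 2 - 1 = 3 := by norm_num
  have e2 : ((2 : ℝ) * 2 + 1) / (2 * 2 - 1) = 5 / 3 := by norm_num
  rw [e2, e1] at hκ
  exact hκ

/-- **The Lyapunov mirrors `EK.EF.s | T_M0` at every real order `s > 1/2`**: there is `κ > 0` such
that `K − ((2s−1)/κ) ν^{γ_s+1} E_s^{−1/(2s−1)}` (`γ_s = (2s+1)/(2s−1)`) is non-increasing on every
positive-`E_s` window of a zero-mean classical solution on `T³` (the law with the constant raised to
`max C 1`, and `SaturatingLaw.antitoneOn_lyapunov`). [ours] -/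
theorem hsEnergy_lyapunov {s : ℝ} (hs : 1 / 2 < s) :
    ∃ κ : ℝ, 0 < κ ∧ ∀ {ν a b : ℝ}, 0 < ν → a < b →
      ∀ {u : ℝ → UnitAddTorus (Fin 3) → EuclideanSpace ℝ (Fin 3)} {p : ℝ → UnitAddTorus (Fin 3) → ℝ},
        Torus.IsClassicalNSSolutionOn (Icc a b) ν 0 u p →
        (∀ t ∈ Icc a b, Torus.HasZeroMean (u t)) →
        (∀ t ∈ Icc a b, 0 < torusHsEnergy s (u t)) →
        AntitoneOn (fun t => Torus.kineticEnergy (u t) -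
            (2 * s - 1) / κ * ν ^ ((2 * s + 1) / (2 * s - 1) + 1) *
              torusHsEnergy s (u t) ^ (-(2 * s - 1)⁻¹)) (Icc a b) := by
  obtain ⟨C, _, h⟩ := exists_hsProductionBound hs
  have hC' : 0 < max C 1 := lt_of_lt_of_le one_pos (le_max_right _ _)
  have h' : HsProductionBound s (max C 1) := h.mono (le_max_left C 1) (by linarith)
  have hlaw := saturatingLaw_torusHsEnergy_of_productionBound hs hC'.le h'
  refine ⟨(max C 1) ^ (4 * s / (2 * s - 1)), Real.rpow_pos_of_pos hC' _,
    fun hν hab u p hsol hmean hpos => ?_⟩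
  exact hlaw.antitoneOn_lyapunov (by linarith) (Real.rpow_pos_of_pos hC' _) (by simp) hν hab hsol hmean hpos

end Summit.NavierStokesRegularity.FunctionalMining
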